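import Summits.CriticalPhenomena.PercolationContinuityZ3.Theorems.PercNearOneGluingNoHeavyLowerTailKnQuestion8CoefficientwisePendant
import Summits.CriticalPhenomena.PercolationContinuityZ3.Theorems.PercNearOneGluingNoHeavyLowerTailKnQuestion8CoefficientwiseOffClusterMajorant
import HarnessLib

/-!
# The two-point exclusion `Q_mix(p,q)` when `q` is a pendant vertex of the root (prim-lf-2 gen 47)

Support file (`--supports stmt-CriticalPhenomena-4575`, closed), prover `prim-lf-2` (gen 47).  No definitions, no named facts, no sorries; standard axioms.
Memo `prim-lf-2/CW-QMIX-gen47.md` §2 (the smallest (G,p,q) instances of CONJECTURE Q_mix not settled by a termwise argument are of this kind).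

Setting as in …CoefficientwiseQmixDominated: `K(s) = C_x(s) = openCluster (ends '' s) x`, `Q_mix(p,q) = Σ_{s : ¬(p ∈ K s ∧ q ∈ K sᶜ)} (f(K s) − f(K sᶜ))(g(K s) − g(K sᶜ))`.
If `q ≠ x` hangs at the root by a single edge `e₀ = {q, x}` (its only edge), then `q ∈ K sᶜ ⇔ e₀ ∉ s`, and resolving the colour of `e₀` gives
  `Q_mix(p,q) = Σ_{t ⊆ E'} (f_q(K t) − f(K t̄))(g_q(K t) − g(K t̄)) + Σ_{t ⊆ E' : p ∉ K t} (f(K t) − f_q(K t̄))(g(K t) − g_q(K t̄))`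
(`E' = E ∖ e₀`, `t̄ = E' ∖ t`, `f_q(C) = f(C ∪ {q}) ≥ f(C)`): a BOOSTED two-colouring Harris sum (after the colour swap on `E'`) plus a BOOSTED off-cluster sum on `G − e₀`, both
`≥ 0` by gen 47's `Coefficientwise.offCluster_boosted_nonneg` (the antitone-majorant form of gen 23's off-cluster theorem), transported to the sub-multigraph `E'`.

* `Coefficientwise.openCluster_insert_rootLeaf` — with the pendant root edge red, `K(insert e₀ t) = insert q (K t)`;
* `Coefficientwise.offCluster_boosted_nonneg_sub` — the boosted off-cluster theorem on a sub-multigraph `E'`;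
* `Coefficientwise.qmix_nonneg_of_rootPendant` — THEOREM: `Q_mix(p,q) ≥ 0` for every vertex `p` when `q` is a pendant vertex of the root, all monotone `f, g`.
[cite: KozmaNitzan2024, Questions 8–9 (§5.5 p. 36) (context: the Question-8 pocket covariance programme)]
-/

namespace Summit.CriticalPhenomena.PercolationContinuityZ3.Theorems

open Finset Literature.Probability.Percolation

namespace Coefficientwise

variable {ι V : Type*} [DecidableEq ι]

/-- With the pendant ROOT edge `e₀ = {z, x}` red (`z ≠ x` a leaf at the root), the red cluster of `x` gains exactly `z`:
`C_x(insert e₀ t) = insert z (C_x t)` for `e₀ ∉ t`. [cite: KozmaNitzan2024, §5.5 (context only)] -/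
theorem openCluster_insert_rootLeaf (ends : ι → Sym2 V) {z x : V} {e₀ : ι} (he₀ : ends e₀ = s(z, x))
    (hpend : ∀ i, z ∈ ends i → i = e₀) (hzx : z ≠ x) {t : Finset ι} (ht : e₀ ∉ t) :
    openCluster (ends '' (↑(insert e₀ t) : Set ι)) x = insert z (openCluster (ends '' (↑t : Set ι)) x) := by
  apply Set.Subset.antisymm
  · -- `insert z (C_x t)` contains `x` and is closed under adjacency in `insert e₀ t`
    set T : Set V := insert z (openCluster (ends '' (↑t : Set ι)) x) with hT
    have htr : ∀ u ∈ T, ∀ w, (openGraph (ends '' (↑(insert e₀ t) : Set ι))).Adj u w →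
        (openGraph (ends '' (↑(insert e₀ t) : Set ι))).Adj u w ∧ w ∈ T := by
      intro u hu w hadj
      refine ⟨hadj, ?_⟩
      rw [openGraph_image_adj] at hadj
      obtain ⟨⟨i, hit, hi⟩, hne⟩ := hadj
      rcases Finset.mem_insert.mp hit with rfl | hit'
      · have hw : w ∈ s(z, x) := by rw [← he₀, hi]; exact Sym2.mem_mk_right u w
        rcases Sym2.mem_iff.mp hw with rfl | rfl
        · exact Set.mem_insert _ _
        · exact Set.mem_insert_of_mem _ (mem_openCluster_self _ _)
      · rcases (Set.mem_insert_iff.mp hu) with rfl | hu'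
        · exfalso
          have : i = e₀ := hpend i (by rw [hi]; exact Sym2.mem_mk_left _ w)
          exact ht (this ▸ hit')
        · have hadj' : (openGraph (ends '' (↑t : Set ι))).Adj u w := by
            rw [openGraph_image_adj]; exact ⟨⟨i, hit', hi⟩, hne⟩
          exact Set.mem_insert_of_mem _ (SimpleGraph.Reachable.trans hu' hadj'.reachable)
    intro y hy
    obtain ⟨p⟩ := hy
    exact ((reachable_transfer T htr p) (Set.mem_insert_of_mem _ (mem_openCluster_self _ x))).2
  · intro y hy
    rcases Set.mem_insert_iff.mp hy with rfl | hy'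
    · have hadj : (openGraph (ends '' (↑(insert e₀ t) : Set ι))).Adj x y := by
        rw [openGraph_image_adj]
        exact ⟨⟨e₀, Finset.mem_insert_self e₀ t, by rw [he₀, Sym2.eq_swap]⟩, hzx.symm⟩
      exact hadj.reachable
    · exact openCluster_image_mono ends (Finset.subset_insert e₀ t) x hy'

open Classical in
/-- **Boosted off-cluster theorem on a sub-multigraph.**  For an edge set `E'`, root `x`, avoided set `A` and monotone `f ≤ f'`, `g ≤ g'`,
`0 ≤ Σ_{t ⊆ E' : A ∩ C_x(t) = ∅} (f(C_x t) − f'(C_x(E' ∖ t)))·(g(C_x t) − g'(C_x(E' ∖ t)))` (`offCluster_boosted_nonneg` transported along `{i // i ∈ E'}`, as in gen 23's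
`offCluster_twoColouring_nonneg_sub`). [cite: KozmaNitzan2024, Questions 8–9 (§5.5 p. 36) (context)] -/
theorem offCluster_boosted_nonneg_sub (ends : ι → Sym2 V) (E' : Finset ι) (x : V) (A : Set V) (f f' g g' : Set V → ℝ)
    (hf : Monotone f) (hg : Monotone g) (hf' : Monotone f') (hg' : Monotone g') (hff' : ∀ C, f C ≤ f' C) (hgg' : ∀ C, g C ≤ g' C) :
    0 ≤ ∑ t ∈ E'.powerset.filter (fun t : Finset ι => ∀ a ∈ A, a ∉ openCluster (ends '' (↑t : Set ι)) x),
      (f (openCluster (ends '' (↑t : Set ι)) x) - f' (openCluster (ends '' (↑(E' \ t) : Set ι)) x)) *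
        (g (openCluster (ends '' (↑t : Set ι)) x) - g' (openCluster (ends '' (↑(E' \ t) : Set ι)) x)) := by
  set emb : {i // i ∈ E'} ↪ ι := Function.Embedding.subtype _ with hemb
  have key := offCluster_boosted_nonneg (ends ∘ Subtype.val : {i // i ∈ E'} → Sym2 V) x A f f' g g' hf hg hf' hg' hff' hgg'
  have map_compl : ∀ t : Finset {i // i ∈ E'}, (tᶜ).map emb = E' \ t.map emb := by
    intro t
    ext i
    simp only [Finset.mem_map, Finset.mem_compl, Finset.mem_sdiff, hemb, Function.Embedding.coe_subtype]
    constructor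
    · rintro ⟨⟨j, hj⟩, hjt, rfl⟩
      exact ⟨hj, fun ⟨⟨k, hk⟩, hkt, hkj⟩ => hjt (by cases hkj; exact hkt)⟩
    · rintro ⟨hiE, hnot⟩
      exact ⟨⟨i, hiE⟩, fun hit => hnot ⟨⟨i, hiE⟩, hit, rfl⟩, rfl⟩
  have map_sub : ∀ t : Finset {i // i ∈ E'}, t.map emb ⊆ E' := by
    intro t i hi
    obtain ⟨⟨j, hj⟩, _, rfl⟩ := Finset.mem_map.mp hi
    exact hj
  refine key.trans_eq ?_
  refine Finset.sum_bij' (fun t _ => t.map emb) (fun t _ => t.subtype (· ∈ E')) ?_ ?_ ?_ ?_ ?_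
  · intro t ht
    rw [Finset.mem_filter] at ht ⊢
    refine ⟨Finset.mem_powerset.mpr (map_sub t), ?_⟩
    rw [← image_map_subtype]; exact ht.2
  · intro t ht
    rw [Finset.mem_filter] at ht ⊢
    refine ⟨Finset.mem_univ _, ?_⟩
    have hsub : t ⊆ E' := Finset.mem_powerset.mp ht.1
    rw [image_map_subtype, Finset.subtype_map_of_mem (fun i hi => hsub hi)]
    exact ht.2
  · intro t _
    ext ⟨i, hi⟩
    rw [Finset.mem_subtype, Finset.mem_map]
    constructor
    · rintro ⟨⟨j, hj⟩, hjt, hji⟩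
      have hji' : j = i := by simpa [hemb] using hji
      subst hji'
      exact hjt
    · intro h
      exact ⟨⟨i, hi⟩, h, by simp [hemb]⟩
  · intro t ht
    have hsub : t ⊆ E' := Finset.mem_powerset.mp (Finset.mem_filter.mp ht).1
    exact Finset.subtype_map_of_mem (fun i hi => hsub hi)
  · intro t _
    rw [image_map_subtype, image_map_subtype ends E' (tᶜ), map_compl]

variable [Fintype ι]

open Classical in
/-- **`Q_mix(p,q) ≥ 0` when `q` is a pendant vertex of the root.**  If `q ≠ x` is a leaf whose only edge `e₀ = {q, x}` goes to the root, then for every vertex `p`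
and all monotone `f, g`:  `0 ≤ Σ_{s : ¬(p ∈ C_x(s) ∧ q ∈ C_x(sᶜ))} (f(C_x s) − f(C_x sᶜ))(g(C_x s) − g(C_x sᶜ))`.
Proof: `q ∈ C_x(sᶜ) ⇔ e₀ ∉ s`; split along `e₀`; with `f_q = f(· ∪ {q})`, the `e₀ ∈ s` half is (after the swap on `E ∖ e₀`) the boosted two-colouring Harris sum
`Σ_t (f(K t) − f_q(K t̄))(g(K t) − g_q(K t̄)) ≥ 0` and the `e₀ ∉ s` half is the boosted off-cluster sum `Σ_{p ∉ K t} (f(K t) − f_q(K t̄))(g(K t) − g_q(K t̄)) ≥ 0`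
(`offCluster_boosted_nonneg_sub` with `A = ∅` and `A = {p}`). [cite: KozmaNitzan2024, Questions 8–9 (§5.5 p. 36) (context)] -/
theorem qmix_nonneg_of_rootPendant (ends : ι → Sym2 V) {q x : V} {e₀ : ι} (he₀ : ends e₀ = s(q, x))
    (hpend : ∀ i, q ∈ ends i → i = e₀) (hqx : q ≠ x) (p : V) (f g : Set V → ℝ) (hf : Monotone f) (hg : Monotone g) :
    0 ≤ ∑ s ∈ univ.filter (fun s : Finset ι =>
        ¬ (p ∈ openCluster (ends '' (↑s : Set ι)) x ∧ q ∈ openCluster (ends '' (↑(sᶜ) : Set ι)) x)),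
      (f (openCluster (ends '' (↑s : Set ι)) x) - f (openCluster (ends '' (↑(sᶜ) : Set ι)) x)) *
        (g (openCluster (ends '' (↑s : Set ι)) x) - g (openCluster (ends '' (↑(sᶜ) : Set ι)) x)) := by
  set K : Finset ι → Set V := fun s => openCluster (ends '' (↑s : Set ι)) x with hK
  set E' : Finset ι := univ.erase e₀ with hE'
  set fq : Set V → ℝ := fun C => f (insert q C) with hfq
  set gq : Set V → ℝ := fun C => g (insert q C) with hgq
  change 0 ≤ ∑ s ∈ univ.filter (fun s : Finset ι => ¬ (p ∈ K s ∧ q ∈ K sᶜ)), (f (K s) - f (K sᶜ)) * (g (K s) - g (K sᶜ))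
  have hfqm : Monotone fq := fun A B hAB => hf (Set.insert_subset_insert hAB)
  have hgqm : Monotone gq := fun A B hAB => hg (Set.insert_subset_insert hAB)
  have hffq : ∀ C, f C ≤ fq C := fun C => hf (Set.subset_insert q C)
  have hggq : ∀ C, g C ≤ gq C := fun C => hg (Set.subset_insert q C)
  have he₀E' : e₀ ∉ E' := fun h => (Finset.mem_erase.mp h).1 rfl
  have huniv : (univ : Finset (Finset ι)) = (insert e₀ E').powerset := by
    rw [hE', Finset.insert_erase (Finset.mem_univ e₀), Finset.powerset_univ]
  have compl_of_sub : ∀ t, t ⊆ E' → tᶜ = insert e₀ (E' \ t) := by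
    intro t ht
    ext i
    simp only [Finset.mem_compl, Finset.mem_insert, Finset.mem_sdiff, hE', Finset.mem_erase, Finset.mem_univ, and_true]
    constructor
    · intro hi
      by_cases hie : i = e₀
      · exact Or.inl hie
      · exact Or.inr ⟨hie, hi⟩
    · rintro (rfl | ⟨_, hi⟩)
      · exact fun h => he₀E' (ht h)
      · exact hi
  have compl_insert_of_sub : ∀ t, t ⊆ E' → (insert e₀ t)ᶜ = E' \ t := by
    intro t ht
    ext i
    simp only [Finset.mem_compl, Finset.mem_insert, Finset.mem_sdiff, hE', Finset.mem_erase, Finset.mem_univ, and_true, not_or]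
  have notin_of_sub : ∀ t, t ⊆ E' → e₀ ∉ t := fun t ht h => he₀E' (ht h)
  have notin_sdiff : ∀ t, e₀ ∉ E' \ t := fun t h => he₀E' (Finset.mem_sdiff.mp h).1
  -- cluster facts for the pendant root edge
  have K_ins : ∀ t, e₀ ∉ t → K (insert e₀ t) = insert q (K t) := fun t ht => openCluster_insert_rootLeaf ends he₀ hpend hqx ht
  have q_notin : ∀ t, e₀ ∉ t → q ∉ K t := fun t ht => leaf_not_mem_openCluster ends hpend hqx ht
  -- the two halves on `G − e₀`
  have hA : 0 ≤ ∑ t ∈ E'.powerset, (f (K t) - fq (K (E' \ t))) * (g (K t) - gq (K (E' \ t))) := by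
    have h := offCluster_boosted_nonneg_sub ends E' x (∅ : Set V) f fq g gq hf hg hfqm hgqm hffq hggq
    have hfilt : E'.powerset.filter (fun t : Finset ι => ∀ a ∈ (∅ : Set V), a ∉ openCluster (ends '' (↑t : Set ι)) x) = E'.powerset :=
      Finset.filter_true_of_mem fun t _ a ha => absurd ha (Set.notMem_empty a)
    rw [hfilt] at h
    simpa [hK, hfq, hgq] using h
  have hB : 0 ≤ ∑ t ∈ E'.powerset.filter (fun t : Finset ι => p ∉ K t), (f (K t) - fq (K (E' \ t))) * (g (K t) - gq (K (E' \ t))) := by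
    have h := offCluster_boosted_nonneg_sub ends E' x ({p} : Set V) f fq g gq hf hg hfqm hgqm hffq hggq
    have hfilt : E'.powerset.filter (fun t : Finset ι => ∀ a ∈ ({p} : Set V), a ∉ openCluster (ends '' (↑t : Set ι)) x) =
        E'.powerset.filter (fun t : Finset ι => p ∉ K t) :=
      Finset.filter_congr fun t _ => by simp [hK]
    rw [hfilt] at h
    simpa [hK, hfq, hgq] using h
  -- split the sum along `e₀`
  rw [Finset.sum_filter, huniv, Finset.sum_powerset_insert he₀E']
  -- `e₀ ∉ s`: `s = t ⊆ E'`, `sᶜ = insert e₀ (E' \ t)`, `q ∈ K sᶜ`; the constraint is `p ∉ K t`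
  have h1 : ∑ t ∈ E'.powerset, (if ¬ (p ∈ K t ∧ q ∈ K tᶜ) then (f (K t) - f (K tᶜ)) * (g (K t) - g (K tᶜ)) else 0) =
      ∑ t ∈ E'.powerset, (if p ∉ K t then (f (K t) - fq (K (E' \ t))) * (g (K t) - gq (K (E' \ t))) else 0) := by
    refine Finset.sum_congr rfl fun t ht => ?_
    have hsub : t ⊆ E' := Finset.mem_powerset.mp ht
    rw [compl_of_sub t hsub, K_ins (E' \ t) (notin_sdiff t)]
    have hq : q ∈ insert q (K (E' \ t)) := Set.mem_insert _ _
    by_cases hp : p ∈ K t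
    · simp [hp, hq]
    · simp [hp, hfq, hgq]
  -- `e₀ ∈ s`: `s = insert e₀ t`, `K s = insert q (K t)`, `sᶜ = E' \ t ∌ q`; no constraint
  have h2 : ∑ t ∈ E'.powerset, (if ¬ (p ∈ K (insert e₀ t) ∧ q ∈ K (insert e₀ t)ᶜ) then
        (f (K (insert e₀ t)) - f (K (insert e₀ t)ᶜ)) * (g (K (insert e₀ t)) - g (K (insert e₀ t)ᶜ)) else 0) =
      ∑ t ∈ E'.powerset, (fq (K t) - f (K (E' \ t))) * (gq (K t) - g (K (E' \ t))) := by
    refine Finset.sum_congr rfl fun t ht => ?_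
    have hsub : t ⊆ E' := Finset.mem_powerset.mp ht
    rw [compl_insert_of_sub t hsub, K_ins t (notin_of_sub t hsub)]
    have hqc : q ∉ K (E' \ t) := q_notin (E' \ t) (notin_sdiff t)
    simp [hqc, hfq, hgq]
  -- the `e₀ ∈ s` half is the boosted sum after the colour swap on `E'`
  have h3 : ∑ t ∈ E'.powerset, (fq (K t) - f (K (E' \ t))) * (gq (K t) - g (K (E' \ t))) =
      ∑ t ∈ E'.powerset, (f (K t) - fq (K (E' \ t))) * (g (K t) - gq (K (E' \ t))) := by
    refine Finset.sum_bij' (fun t _ => E' \ t) (fun t _ => E' \ t) ?_ ?_ ?_ ?_ ?_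
    · intro t _; exact Finset.mem_powerset.mpr Finset.sdiff_subset
    · intro t _; exact Finset.mem_powerset.mpr Finset.sdiff_subset
    · intro t ht; exact Finset.sdiff_sdiff_eq_self (Finset.mem_powerset.mp ht)
    · intro t ht; exact Finset.sdiff_sdiff_eq_self (Finset.mem_powerset.mp ht)
    · intro t ht
      have hsub : t ⊆ E' := Finset.mem_powerset.mp ht
      rw [Finset.sdiff_sdiff_eq_self hsub]; ring
  rw [h1, h2, h3, ← Finset.sum_filter]
  linarith [hA, hB]

end Coefficientwise

end Summit.CriticalPhenomena.PercolationContinuityZ3.Theorems
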